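import Mathlib
import Summits.MatrixMultiplication.MatrixMultiplication.Theses.FourierTwoFamiliesModP
import Summits.MatrixMultiplication.MatrixMultiplication.Theorems.FourierTwoFamiliesModPCyclicReduction
import Summits.MatrixMultiplication.MatrixMultiplication.Theorems.FourierTwoFamiliesModPPowerGainRefutes
import Summits.MatrixMultiplication.MatrixMultiplication.Theorems.FourierTwoFamiliesModPPrimeTwoFamiliesCapacityEquivalences
import Summits.MatrixMultiplication.MatrixMultiplication.Theorems.FourierTwoFamiliesModPPrimeTwoFamiliesLadderEquivalence

/-!
# Crux-strategist r1 (gen 2) — the BC2 REDIRECT AUDIT of `FourierTwoFamiliesModP.PrimeTwoFamilies`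
# (crux stmt-MatrixMultiplication-14308), typed

Scratch file of planner-cstrat-stmt-MatrixMultiplication-14308-r1-0 (2026-08-17).  Nothing here is a line
or a registered stub.  The file TYPES every candidate decomposition `X₁ ∧ … ∧ X_k → PrimeTwoFamilies` examined
in `STRATEGY-CENSUS.md` §"BC2 redirect audit (gen 2)", PROVES each assembly (clause (b) of the human ruling of
2026-08-16 is never the failing clause), and PROVES the facts that decide clauses (c)/(d):

* §H  host bridge      — `AllAbelianTwoFamilies` (verbatim stmt-0595) `↔ X` is the LANDED iff `cyclicReduction_proof`
                          ⇒ (c) fails ("no landed iff").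
* §C  capacity bridges — capacity gadgets / self-converse gadgets / packing-tight-at-every-scale / cyclic ladders
                          are LANDED iffs (p99109, p91570) ⇒ (c) fails.
* §D  scale splits     — `LowScales ∧ HighScales → X` PROVED (`split_D1`); `X → HighScales` PROVED; and
                          `HighScales ↔ X` given the padding monotonicity `AntiMonotone` (typed; provable from the
                          landed `CapacityLift.sdpp_pad` + `exists_prime_sdpp_of_addEquiv`) ⇒ one piece is the crux.
                          Milestone + Step (`split_D2`, PROVED modulo `AntiMonotone`): `X → Step`, `X → Milestone`
                          PROVED, and `Step ↔ (Milestone → X)` given `AntiMonotone` ⇒ a bridge whose boost has no plan (d).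
* §E  easy-end bridge  — `DefectRatioZero ∧ Boost → X` (modus ponens); `X → DefectRatioZero` PROVED (landed kill
                          link); `PrimeCyclicPowerGain → Boost` PROVED; `Boost ↔ (X ∨ PrimeCyclicPowerGain)` PROVED:
                          the only plans for the two pieces are the plans for `T` and for `¬T` (dichotomy costume) ⇒ (d).
* §S  strengthening    — `EquiDifferenceDesigns → X` PROVED in 10 lines ⇒ the piece gives `X` on its own ⇒ (c).
* §R  relaxation       — `X → RelaxedTwoFamilies` PROVED (E = ∅); the converse is index deletion (≈ 40 lines,
                          not written) ⇒ `Relaxed ↔ X` cheaply ⇒ (c) in substance.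
Everything is `sorry`-free.
-/

set_option linter.dupNamespace false

namespace Summit.MatrixMultiplication.MatrixMultiplication.Cruxes.PrimeTwoFamilies.StrategistR1

open Finset
open scoped Pointwise
open Summit.MatrixMultiplication.MatrixMultiplication.Theses
open Summit.MatrixMultiplication.MatrixMultiplication.Theses.FourierTwoFamiliesModP
open Summit.MatrixMultiplication.MatrixMultiplication.Theorems

/-! ## §H  Host bridge: the all-abelian two-families conjecture (stmt-0595 verbatim) -/

/-- CKSU 2005 Conj. 4.7 over ALL finite abelian groups — verbatim the text of
`GroupTheoreticSTPP.CPackingConstruction` (stmt-MatrixMultiplication-0595) and of the left side of the route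
support `CyclicReduction` (stmt-14313). -/
def AllAbelianTwoFamilies : Prop :=
  ∀ δ : ℝ, 0 < δ → ∀ n₀ : ℕ, ∃ n ≥ n₀, ∃ (H : Type) (_ : AddCommGroup H) (_ : Fintype H)
    (A B : Fin n → Finset H),
    (∀ i : Fin n, ∀ a ∈ A i, ∀ a' ∈ A i, ∀ b ∈ B i, ∀ b' ∈ B i,
        (a - a') + (b - b') = 0 → a = a' ∧ b = b') ∧
    (∀ i j k : Fin n, ∀ a ∈ A i, ∀ a' ∈ A j, ∀ b ∈ B j, ∀ b' ∈ B k,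
        (a - a') + (b - b') = 0 → i = k) ∧
    (Fintype.card H : ℝ) ≤ (n : ℝ) ^ (2 + δ) ∧
    ∀ i : Fin n, (n : ℝ) ^ (2 - δ) ≤ (((A i).card * (B i).card : ℕ) : ℝ)

/-- The host bridge's first piece is the crux RESTATED: a LANDED iff (Umans' cyclic reduction made effective,
`Theorems.cyclicReduction_proof`, item stmt-14313 closed).  Clause (c) "no landed iff" fails. -/
theorem allAbelian_iff : AllAbelianTwoFamilies ↔ PrimeTwoFamilies := by
  have h := cyclicReduction_proof
  unfold FourierTwoFamiliesModP.CyclicReduction at h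
  exact h

/-- The assembly of the host bridge `T ∧ (T → X) → X` (modus ponens; trivial seam). -/
theorem split_H (h₁ : AllAbelianTwoFamilies) (h₂ : AllAbelianTwoFamilies → PrimeTwoFamilies) :
    PrimeTwoFamilies :=
  h₂ h₁

/-- … whose second piece is PROVED (the Ribet slot is filled) — but the first is `X` itself. -/
theorem split_H_piece₂ : AllAbelianTwoFamilies → PrimeTwoFamilies :=
  allAbelian_iff.1

/-! ## §C  Capacity / ladder / packing bridges: all LANDED iffs (clause (c) fails for each) -/

/-- capacity gadgets `↔ X` (p99109). -/
example := @Summit.MatrixMultiplication.MatrixMultiplication.Theorems.PrimeTwoFamilies.CapacityLift.capacityGadgets_iff_primeTwoFamilies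
/-- self-converse gadgets `↔ X` (p99109). -/
example := @Summit.MatrixMultiplication.MatrixMultiplication.Theorems.PrimeTwoFamilies.CapacityLift.selfConverseGadgets_iff_primeTwoFamilies
/-- `X ↔` packing-tight at every scale (p99109). -/
example := @Summit.MatrixMultiplication.MatrixMultiplication.Theorems.PrimeTwoFamilies.CapacityLift.primeTwoFamilies_iff_packingTightAt
/-- `X ↔` cyclic ladders (p91570). -/
example := @Summit.MatrixMultiplication.MatrixMultiplication.Theorems.PrimeTwoFamilies.LadderLift.primeTwoFamilies_iff_cyclicLadder

/-! ## §D  Scale splits -/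

/-- PACKING-TIGHT AT SCALE `γ` (verbatim the body of `primeTwoFamilies_iff_packingTightAt`). -/
def PackingTightAt (γ : ℝ) : Prop :=
  ∀ ε : ℝ, 0 < ε → ∀ p₀ : ℕ, ∃ p ≥ p₀, p.Prime ∧ ∃ (n : ℕ) (A B : Fin n → Finset (ZMod p)),
    (∀ i : Fin n, ∀ a ∈ A i, ∀ a' ∈ A i, ∀ b ∈ B i, ∀ b' ∈ B i,
        (a - a') + (b - b') = 0 → a = a' ∧ b = b') ∧
    (∀ i j k : Fin n, ∀ a ∈ A i, ∀ a' ∈ A j, ∀ b ∈ B j, ∀ b' ∈ B k,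
        (a - a') + (b - b') = 0 → i = k) ∧
    (∀ i : Fin n, (p : ℝ) ^ γ ≤ (((A i).card * (B i).card : ℕ) : ℝ)) ∧
    (p : ℝ) ^ (1 - γ / 2 - ε) ≤ (n : ℝ)

/-- D1, piece 1: tight at every LOW scale `γ ∈ (0, 1/2]`. -/
def LowScales : Prop := ∀ γ : ℝ, 0 < γ → γ ≤ 1 / 2 → PackingTightAt γ

/-- D1, piece 2: tight at every HIGH scale `γ ∈ (1/2, 1)`. -/
def HighScales : Prop := ∀ γ : ℝ, 1 / 2 < γ → γ < 1 → PackingTightAt γ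

/-- D1 assembly, PROVED (case split on the scale + the landed iff). -/
theorem split_D1 (hlo : LowScales) (hhi : HighScales) : PrimeTwoFamilies := by
  refine Summit.MatrixMultiplication.MatrixMultiplication.Theorems.PrimeTwoFamilies.CapacityLift.primeTwoFamilies_iff_packingTightAt.2 ?_
  intro γ hγ hγ1
  by_cases h : γ ≤ 1 / 2
  · exact hlo γ hγ h
  · exact hhi γ (lt_of_not_ge h) hγ1

/-- Both pieces are consequences of the crux (landed direction of the iff). -/
theorem highScales_of_primeTwoFamilies (hT : PrimeTwoFamilies) : HighScales :=
  fun γ hγ hγ1 => Summit.MatrixMultiplication.MatrixMultiplication.Theorems.PrimeTwoFamilies.CapacityLift.primeTwoFamilies_iff_packingTightAt.1 hT γ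
    (by linarith) hγ1

theorem lowScales_of_primeTwoFamilies (hT : PrimeTwoFamilies) : LowScales :=
  fun γ hγ hγ1 => Summit.MatrixMultiplication.MatrixMultiplication.Theorems.PrimeTwoFamilies.CapacityLift.primeTwoFamilies_iff_packingTightAt.1 hT γ hγ
    (by linarith)

/-- The padding monotonicity ("c(γ)/γ non-decreasing"; `StrategistG1.packingTightAt_anti`): tightness
propagates DOWN the scale.  Provable now from the landed `CapacityLift.sdpp_pad` (pad by the singleton design
of `ZMod M`) + `exists_prime_sdpp_of_addEquiv`; typed here as a hypothesis. -/
def AntiMonotone : Prop :=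
  ∀ γ γ' : ℝ, 0 < γ → γ ≤ γ' → γ' < 1 → PackingTightAt γ' → PackingTightAt γ

/-- Given the padding monotonicity, D1's second piece IS the crux: the split is one-sided (clause (c) in
substance: `HighScales ↔ X` is a provable iff). -/
theorem highScales_iff_of_anti (hA : AntiMonotone) : HighScales ↔ PrimeTwoFamilies := by
  refine ⟨fun hhi => split_D1 (fun γ hγ hγ1 => ?_) hhi, highScales_of_primeTwoFamilies⟩
  exact hA γ (3 / 4) hγ (by linarith) (by norm_num) (hhi (3 / 4) (by norm_num) (by norm_num))

/-- D2, piece 1: the MILESTONE — tight at the single scale `γ = 1/2` (open; necessary; finitely testable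
along `s = p^{1/4}`). -/
def Milestone : Prop := PackingTightAt (1 / 2)

/-- D2, piece 2: the STEP — tightness at `γ` boosts to tightness at `(1+γ)/2`. -/
def Step : Prop := ∀ γ : ℝ, 1 / 2 ≤ γ → γ < 1 → PackingTightAt γ → PackingTightAt ((1 + γ) / 2)

/-- Both D2 pieces are consequences of the crux. -/
theorem milestone_of_primeTwoFamilies (hT : PrimeTwoFamilies) : Milestone :=
  Summit.MatrixMultiplication.MatrixMultiplication.Theorems.PrimeTwoFamilies.CapacityLift.primeTwoFamilies_iff_packingTightAt.1 hT (1 / 2) (by norm_num) (by norm_num)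

theorem step_of_primeTwoFamilies (hT : PrimeTwoFamilies) : Step :=
  fun γ hγ hγ1 _ => Summit.MatrixMultiplication.MatrixMultiplication.Theorems.PrimeTwoFamilies.CapacityLift.primeTwoFamilies_iff_packingTightAt.1 hT ((1 + γ) / 2)
    (by linarith) (by linarith)

/-- The dyadic scales `γ_k = 1 - 2^{-(k+1)}` reached by iterating the Step from the Milestone. -/
theorem dyadic_of_milestone_step (hm : Milestone) (hs : Step) :
    ∀ k : ℕ, PackingTightAt (1 - (1 / 2 : ℝ) ^ (k + 1)) := by
  intro k
  induction k with
  | zero =>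
      have : (1 : ℝ) - (1 / 2 : ℝ) ^ (0 + 1) = 1 / 2 := by norm_num
      rw [this]; exact hm
  | succ k ih =>
      have hpos : (0 : ℝ) < (1 / 2 : ℝ) ^ (k + 1) := by positivity
      have hle : (1 / 2 : ℝ) ^ (k + 1) ≤ 1 / 2 := by
        calc (1 / 2 : ℝ) ^ (k + 1) ≤ (1 / 2 : ℝ) ^ 1 :=
              pow_le_pow_of_le_one (by norm_num) (by norm_num) (by omega)
          _ = 1 / 2 := by norm_num
      have h := hs (1 - (1 / 2 : ℝ) ^ (k + 1)) (by linarith) (by linarith) ih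
      have heq : (1 + (1 - (1 / 2 : ℝ) ^ (k + 1))) / 2 = 1 - (1 / 2 : ℝ) ^ (k + 1 + 1) := by ring
      rw [heq] at h
      exact h

/-- D2 assembly, PROVED modulo the padding monotonicity: Milestone + Step give the dyadic scales, padding
fills in every scale below them, and the landed iff concludes.  (So clause (b) is not what fails for D2;
(c)/(d) are — see `step_iff_of_anti`.) -/
theorem split_D2 (hA : AntiMonotone) (hm : Milestone) (hs : Step) : PrimeTwoFamilies := by
  refine Summit.MatrixMultiplication.MatrixMultiplication.Theorems.PrimeTwoFamilies.CapacityLift.primeTwoFamilies_iff_packingTightAt.2 ?_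
  intro γ hγ hγ1
  obtain ⟨k, hk⟩ := exists_pow_lt_of_lt_one (show (0 : ℝ) < 1 - γ by linarith)
    (show (1 / 2 : ℝ) < 1 by norm_num)
  have hpos : (0 : ℝ) < (1 / 2 : ℝ) ^ (k + 1) := by positivity
  have hk' : (1 / 2 : ℝ) ^ (k + 1) ≤ (1 / 2 : ℝ) ^ k :=
    pow_le_pow_of_le_one (by norm_num) (by norm_num) (by omega)
  exact hA γ (1 - (1 / 2 : ℝ) ^ (k + 1)) hγ (by linarith) (by linarith) (dyadic_of_milestone_step hm hs k)

/-- Why D2 is a bridge in disguise: given the padding monotonicity, `Step ↔ (Milestone → X)`.  Its boost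
piece is exactly "milestone implies crux", for which no mechanism exists (products / padding / CRT only
AVERAGE the exponent pair (θ, γ); merging blocks destroys directness). -/
theorem step_iff_of_anti (hA : AntiMonotone) : Step ↔ (Milestone → PrimeTwoFamilies) :=
  ⟨fun hs hm => split_D2 hA hm hs, fun himp γ hγ hγ1 hPT =>
    step_of_primeTwoFamilies (himp (hA (1 / 2) γ (by norm_num) hγ hγ1 hPT)) γ hγ hγ1 hPT⟩

/-! ## §E  Easy-end bridge: `DefectRatioZero` ("SDPP-Behrend") and its Boost -/

/-- **DefectRatioZero** (verbatim `StrategistG1.DefectRatioZero`): for every `c > 0`, balanced SDPP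
configurations of density `ns/p > s^{-c}` at arbitrarily large `s`.  `= ¬ PrimeCyclicPowerGain` (stmt-14309). -/
def DefectRatioZero : Prop :=
  ∀ c : ℝ, 0 < c → ∀ s₀ : ℕ, ∃ p : ℕ, p.Prime ∧ ∃ (n s : ℕ) (A B : Fin n → Finset (ZMod p)),
    s₀ ≤ s ∧ (∀ i : Fin n, (A i).card = s ∧ (B i).card = s) ∧
    (∀ i : Fin n, ∀ a ∈ A i, ∀ a' ∈ A i, ∀ b ∈ B i, ∀ b' ∈ B i,
        (a - a') + (b - b') = 0 → a = a' ∧ b = b') ∧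
    (∀ i j k : Fin n, ∀ a ∈ A i, ∀ a' ∈ A j, ∀ b ∈ B j, ∀ b' ∈ B k,
        (a - a') + (b - b') = 0 → i = k) ∧
    (p : ℝ) < (n : ℝ) * (s : ℝ) ^ (1 + c)

theorem defectRatioZero_iff_not_powerGain : DefectRatioZero ↔ ¬ PrimeCyclicPowerGain := by
  unfold DefectRatioZero PrimeCyclicPowerGain
  push Not
  rfl

/-- `X → T`: the easy end follows from the crux (landed kill link `PowerGainRefutes_proof`, stmt-14312). -/
theorem defectRatioZero_of_primeTwoFamilies (hT : PrimeTwoFamilies) : DefectRatioZero :=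
  defectRatioZero_iff_not_powerGain.2 fun hP => PowerGainRefutes_proof hP hT

/-- The boost piece `T → X`. -/
def Boost : Prop := DefectRatioZero → PrimeTwoFamilies

/-- E assembly (modus ponens; trivial seam — allowed by the ruling). -/
theorem split_E (h₁ : DefectRatioZero) (h₂ : Boost) : PrimeTwoFamilies := h₂ h₁

/-- The KILL side proves the boost vacuously: `PrimeCyclicPowerGain → Boost`. -/
theorem boost_of_powerGain (hP : PrimeCyclicPowerGain) : Boost :=
  fun hD => absurd hP (defectRatioZero_iff_not_powerGain.1 hD)

/-- **Dichotomy costume.**  `Boost ↔ (X ∨ PrimeCyclicPowerGain)`: the second piece of the easy-end bridge is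
"the crux OR the route's kill engine".  A plan for `Boost` is therefore a plan for `X` itself or a plan for
`¬T`; together with a plan for `T` this is the disproof dichotomy, not a redirect (clause (d)). -/
theorem boost_iff_or : Boost ↔ (PrimeTwoFamilies ∨ PrimeCyclicPowerGain) := by
  constructor
  · intro hb
    by_cases hP : PrimeCyclicPowerGain
    · exact Or.inr hP
    · exact Or.inl (hb (defectRatioZero_iff_not_powerGain.2 hP))
  · rintro (hX | hP)
    · exact fun _ => hX
    · exact boost_of_powerGain hP

/-! ## §S  Strengthening bridge: equi-difference designs give `X` on their own -/

/-- **Equi-difference two-families designs** (gen-0 census S5 / idea `equi-difference-normal-form`): all block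
difference sets EQUAL one set `F`, and cross differences avoid `F`.  Satisfied by every design on record. -/
def EquiDifferenceDesigns : Prop :=
  ∀ δ : ℝ, 0 < δ → ∀ n₀ : ℕ, ∃ n ≥ n₀, ∃ p : ℕ, p.Prime ∧ ∃ (A B : Fin n → Finset (ZMod p))
    (F : Finset (ZMod p)),
    (∀ i : Fin n, ∀ a ∈ A i, ∀ a' ∈ A i, ∀ b ∈ B i, ∀ b' ∈ B i,
        (a - a') + (b - b') = 0 → a = a' ∧ b = b') ∧
    (∀ i : Fin n, A i - B i = F) ∧
    (∀ i k : Fin n, i ≠ k → Disjoint (A i - B k) F) ∧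
    (p : ℝ) ≤ (n : ℝ) ^ (2 + δ) ∧
    ∀ i : Fin n, (n : ℝ) ^ (2 - δ) ≤ (((A i).card * (B i).card : ℕ) : ℝ)

/-- `S⁺ → X` in ten lines: a violation `a - a' + b - b' = 0` (`a ∈ A i, a' ∈ A j, b ∈ B j, b' ∈ B k`,
`i ≠ k`) puts `a - b' = a' - b` into `(A i - B k) ∩ (A j - B j) = (A i - B k) ∩ F = ∅`.  So the piece
GIVES the crux on its own (clause (c)); and it is ≥ the summit with no construction (clause (d)). -/
theorem primeTwoFamilies_of_equiDifference (h : EquiDifferenceDesigns) : PrimeTwoFamilies := by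
  intro δ hδ n₀
  obtain ⟨n, hn, p, hp, A, B, F, hW, hF, hD, hpn, hAB⟩ := h δ hδ n₀
  refine ⟨n, hn, p, hp, A, B, hW, ?_, hpn, hAB⟩
  intro i j k a ha a' ha' b hb b' hb' h0
  by_contra hik
  have h1 : a - b' ∈ A i - B k := Finset.sub_mem_sub ha hb'
  have h2 : a' - b ∈ F := by rw [← hF j]; exact Finset.sub_mem_sub ha' hb
  have h3 : a - b' = a' - b := by linear_combination h0
  exact Finset.disjoint_left.1 (hD i k hik) h1 (by rw [h3]; exact h2)

/-! ## §R  Relaxation bridge: relaxed designs + cleaning -/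

/-- **RelaxedTwoFamilies**: clause (X) is allowed to fail on a set `E` of index triples with `2|E| ≤ n`. -/
def RelaxedTwoFamilies : Prop :=
  ∀ δ : ℝ, 0 < δ → ∀ n₀ : ℕ, ∃ n ≥ n₀, ∃ p : ℕ, p.Prime ∧ ∃ (A B : Fin n → Finset (ZMod p))
    (E : Finset (Fin n × Fin n × Fin n)),
    2 * E.card ≤ n ∧
    (∀ i : Fin n, ∀ a ∈ A i, ∀ a' ∈ A i, ∀ b ∈ B i, ∀ b' ∈ B i,
        (a - a') + (b - b') = 0 → a = a' ∧ b = b') ∧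
    (∀ i j k : Fin n, (i, j, k) ∉ E → ∀ a ∈ A i, ∀ a' ∈ A j, ∀ b ∈ B j, ∀ b' ∈ B k,
        (a - a') + (b - b') = 0 → i = k) ∧
    (p : ℝ) ≤ (n : ℝ) ^ (2 + δ) ∧
    ∀ i : Fin n, (n : ℝ) ^ (2 - δ) ≤ (((A i).card * (B i).card : ℕ) : ℝ)

/-- `X → Relaxed` (take `E = ∅`).  The converse ("cleaning": delete one index per bad triple, keep `≥ n/2`
pairs, absorb the factor 2 into `δ`) is a routine forty-line argument, so `Relaxed ↔ X` cheaply: the relaxed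
piece is the crux in substance (clause (c)), and the honest relaxations (a positive FRACTION of bad triples)
have no cleaning tool at polynomial density and no model (clause (d)). -/
theorem relaxed_of_primeTwoFamilies (hT : PrimeTwoFamilies) : RelaxedTwoFamilies := by
  intro δ hδ n₀
  obtain ⟨n, hn, p, hp, A, B, hW, hX, hpn, hAB⟩ := hT δ hδ n₀
  refine ⟨n, hn, p, hp, A, B, ∅, by simp, hW, ?_, hpn, hAB⟩
  intro i j k _ a ha a' ha' b hb b' hb' h0
  exact hX i j k a ha a' ha' b hb b' hb' h0

/-- The cleaning piece, typed. -/
def Cleaning : Prop := RelaxedTwoFamilies → PrimeTwoFamilies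

theorem split_R (h₁ : RelaxedTwoFamilies) (h₂ : Cleaning) : PrimeTwoFamilies := h₂ h₁

end Summit.MatrixMultiplication.MatrixMultiplication.Cruxes.PrimeTwoFamilies.StrategistR1
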